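import Literature.MeasureTheory.Group.InvariantQuotientOrbitalProd
import HarnessLib

/-!
# The product orbital measure `μ₁ ⊠ μ₂` on `G ⧸ C(γ)` for `G ≅ G₁ × G₂`, `γ ↔ (γ₁, γ₂)`, with the EXACT factorisation
# `∫_{G/C(γ)} Φ(yγy⁻¹) d(μ₁ ⊠ μ₂)(y) = (∫_{G₁/C(γ₁)} ξ(aγ₁a⁻¹) dμ₁(a)) · (∫_{G₂/C(γ₂)} Θ(kγ₂k⁻¹) dμ₂(k))` — constant `1`
(Gelbart, *Automorphic forms on adele groups* (1975), p. 155 (10.19); Folland (1995), Thm. 2.49)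

Topic `MeasureTheory/Group`; namespace `Literature.MeasureTheory.Group`. ONE definition with body (`orbitalMeasureOfProd`) and
theorems; no named fact, no instance visible to importers, no `sorry`.

★ `InvariantQuotientOrbitalProd` proves that for ANY admissible (invariant, finite on compacta, non-zero) measure `μ` on
`G ⧸ C(γ)` the orbital integrals of factorizable `Φ = ξ ⊗ Θ` factor as `c · O_{γ₁}^{μ₁}(ξ) · O_{γ₂}^{μ₂}(Θ)` with SOME `c ≠ 0`
(uniqueness of invariant measures).  Here the measure on `G ⧸ C(γ)` is CONSTRUCTED from `μ₁`, `μ₂` — the transport of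
`μ₁ ⊗ μ₂` along `(G₁ ⧸ C(γ₁)) × (G₂ ⧸ C(γ₂)) ≃ₜ (G₁ × G₂) ⧸ (C(γ₁) × C(γ₂)) ≃ G ⧸ C(γ)` (★ `quotientProdHomeomorph`, ★ `cosetCongr e`
with `C(γ) = e(C(γ₁) × C(γ₂))`, ★ `forall_apply_mem_centralizer_iff`) — so that the constant is `1` BY CONSTRUCTION and no
uniqueness theorem (hence no local compactness / closedness hypothesis) is needed for the factorisation:

* `orbitalMeasureOfProd e hγ μ₁ μ₂ : Measure (G ⧸ C(γ))` (the Borel σ-algebra of the intermediate coset space is fixed in the body);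
* `smulInvariantMeasure_orbitalMeasureOfProd`, `isFiniteMeasureOnCompacts_orbitalMeasureOfProd`, `orbitalMeasureOfProd_ne_zero`,
  `sFinite_orbitalMeasureOfProd` — admissibility is inherited from `μ₁`, `μ₂`;
* **`integral_descConj_orbitalMeasureOfProd`** — the exact Bochner factorisation above for all complex `Φ, ξ, Θ` with
  `Φ(e(a, k)) = ξ(a) Θ(k)` (no integrability hypothesis: both sides use Bochner conventions, ★ `integral_prod_mul`);
  **`lintegral_descConj_orbitalMeasureOfProd`** — the `[0, ∞]`-valued twin for measurable `ξ, Θ ≥ 0` (Tonelli);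
  `integrable_descConj_orbitalMeasureOfProd_iff` ∕ `integrable_descConj_orbitalMeasureOfProd` — integrability of the orbital integrand
  of `Φ` is integrability of `ξ ⊗ Θ` for `μ₁ ⊗ μ₂`, in particular it follows from that of the two factors (★ `Integrable.mul_prod`).

This is the `∞ × f` step (`G(𝔸) = G_∞ × G(𝔸_f)`, [BorelJacquet1979, §4.1]) of the construction of global orbital measures FROM local
ones with Euler product `Φ(γ, ⊗ f_v) = ∏_v Φ_v(γ_v, f_v)` on the nose [Rogawski1990, §5.4 p. 72]; the finite-adelic restricted-product step
is ★ `Literature.NumberTheory.Automorphic.orbitalMeasureOfLocal`.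

## References
* S. Gelbart, *Automorphic forms on adele groups*, Ann. of Math. Stud. 83 (1975), p. 155 (10.19) [Gelbart1975].
* G. B. Folland, *A Course in Abstract Harmonic Analysis* (1995), §2.6, Thm. 2.49 [Folland1995].
* A. Borel, H. Jacquet, *Automorphic forms and automorphic representations*, PSPM 33.1 (1979), §4.1 [BorelJacquet1979].
-/

noncomputable section

open MeasureTheory MeasureTheory.Measure Topology Filter
open scoped NNReal ENNReal

namespace Literature.MeasureTheory.Group

section OfProd

variable {G₁ G₂ G : Type*} [Group G₁] [Group G₂] [Group G]
  [TopologicalSpace G₁] [TopologicalSpace G₂] [IsTopologicalGroup G₁] [IsTopologicalGroup G₂]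
  (e : G₁ × G₂ ≃* G) {γ : G} {γ₁ : G₁} {γ₂ : G₂} (hγ : e (γ₁, γ₂) = γ)
  [MeasurableSpace (G ⧸ Subgroup.centralizer ({γ} : Set G))]
  [MeasurableSpace (G₁ ⧸ Subgroup.centralizer ({γ₁} : Set G₁))]
  [MeasurableSpace (G₂ ⧸ Subgroup.centralizer ({γ₂} : Set G₂))]
  (μ₁ : Measure (G₁ ⧸ Subgroup.centralizer ({γ₁} : Set G₁)))
  (μ₂ : Measure (G₂ ⧸ Subgroup.centralizer ({γ₂} : Set G₂)))

/-- **The product orbital measure `μ₁ ⊠ μ₂` on `G ⧸ C(γ)`** for `e : G₁ × G₂ ≃* G` and `γ = e(γ₁, γ₂)`: the transport of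
`μ₁ ⊗ μ₂` along `(G₁ ⧸ C(γ₁)) × (G₂ ⧸ C(γ₂)) ≃ₜ (G₁ × G₂) ⧸ (C(γ₁) × C(γ₂))` (★ `quotientProdHomeomorph`) and
`cosetCongr e : (G₁ × G₂) ⧸ (C(γ₁) × C(γ₂)) → G ⧸ C(γ)` (`C(γ) = e(C(γ₁) × C(γ₂))`).  The Borel σ-algebra of the intermediate coset
space is fixed inside the body. [cite: Gelbart1975, p. 155 (10.19)] -/
def orbitalMeasureOfProd : Measure (G ⧸ Subgroup.centralizer ({γ} : Set G)) :=
  letI : MeasurableSpace ((G₁ × G₂) ⧸ (Subgroup.centralizer ({γ₁} : Set G₁)).prod (Subgroup.centralizer ({γ₂} : Set G₂))) :=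
    borel _
  ((μ₁.prod μ₂).map (quotientProdHomeomorph _ _).symm).map
    (cosetCongr e _ (Subgroup.centralizer ({γ} : Set G)) (forall_apply_mem_centralizer_iff e hγ))

/-- `μ₁ ⊠ μ₂` is s-finite when `μ₁`, `μ₂` are. [cite: Gelbart1975, p. 155 (10.19)] -/
theorem sFinite_orbitalMeasureOfProd [SFinite μ₁] [SFinite μ₂] : SFinite (orbitalMeasureOfProd e hγ μ₁ μ₂) := by
  unfold orbitalMeasureOfProd
  infer_instance

variable [TopologicalSpace G] (he : Continuous e) (hes : Continuous e.symm)

include he hes in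
/-- `μ₁ ⊠ μ₂` read through the homeomorphism `cosetCongrHomeomorph e`: the pushforward of `(quotientProdHomeomorph)⁻¹_* (μ₁ ⊗ μ₂)`.
[cite: Gelbart1975, p. 155 (10.19)] -/
theorem orbitalMeasureOfProd_eq_map :
    orbitalMeasureOfProd e hγ μ₁ μ₂ =
      @Measure.map _ _ (borel _) _
        (cosetCongrHomeomorph e _ (Subgroup.centralizer ({γ} : Set G)) (forall_apply_mem_centralizer_iff e hγ) he hes)
        (@Measure.map _ _ _ (borel _) (quotientProdHomeomorph (Subgroup.centralizer ({γ₁} : Set G₁))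
          (Subgroup.centralizer ({γ₂} : Set G₂))).symm (μ₁.prod μ₂)) := rfl

variable [BorelSpace (G ⧸ Subgroup.centralizer ({γ} : Set G))]
  [BorelSpace (G₁ ⧸ Subgroup.centralizer ({γ₁} : Set G₁))] [BorelSpace (G₂ ⧸ Subgroup.centralizer ({γ₂} : Set G₂))]
  [SecondCountableTopology (G₁ ⧸ Subgroup.centralizer ({γ₁} : Set G₁))]
  [SecondCountableTopology (G₂ ⧸ Subgroup.centralizer ({γ₂} : Set G₂))]

omit [SecondCountableTopology (G₁ ⧸ Subgroup.centralizer ({γ₁} : Set G₁))] in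
include he hes in
/-- **Exact change of variables**: `∫_{G/C(γ)} F d(μ₁ ⊠ μ₂) = ∫ F(e(a, k) C(γ)) d(μ₁ ⊗ μ₂)(aC(γ₁), kC(γ₂))` for every Banach-valued `F`
(no integrability needed). [cite: Gelbart1975, p. 155 (10.19)] -/
theorem integral_orbitalMeasureOfProd {E : Type*} [NormedAddCommGroup E] [NormedSpace ℝ E] [SFinite μ₂]
    (F : G ⧸ Subgroup.centralizer ({γ} : Set G) → E) :
    ∫ y, F y ∂orbitalMeasureOfProd e hγ μ₁ μ₂ =
      ∫ p, F (cosetCongr e _ (Subgroup.centralizer ({γ} : Set G)) (forall_apply_mem_centralizer_iff e hγ)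
        ((QuotientGroup.prodEquiv _ _).symm p)) ∂μ₁.prod μ₂ := by
  letI : MeasurableSpace ((G₁ × G₂) ⧸ (Subgroup.centralizer ({γ₁} : Set G₁)).prod (Subgroup.centralizer ({γ₂} : Set G₂))) :=
    borel _
  haveI : BorelSpace ((G₁ × G₂) ⧸ (Subgroup.centralizer ({γ₁} : Set G₁)).prod (Subgroup.centralizer ({γ₂} : Set G₂))) := ⟨rfl⟩
  rw [orbitalMeasureOfProd_eq_map e hγ μ₁ μ₂ he hes, ← Homeomorph.toMeasurableEquiv_coe, integral_map_equiv,
    ← Homeomorph.toMeasurableEquiv_coe, integral_map_equiv]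
  rfl

omit [SecondCountableTopology (G₁ ⧸ Subgroup.centralizer ({γ₁} : Set G₁))] in
include he hes in
/-- The `[0, ∞]`-valued change of variables for `μ₁ ⊠ μ₂`. [cite: Gelbart1975, p. 155 (10.19)] -/
theorem lintegral_orbitalMeasureOfProd [SFinite μ₂] (F : G ⧸ Subgroup.centralizer ({γ} : Set G) → ℝ≥0∞) :
    ∫⁻ y, F y ∂orbitalMeasureOfProd e hγ μ₁ μ₂ =
      ∫⁻ p, F (cosetCongr e _ (Subgroup.centralizer ({γ} : Set G)) (forall_apply_mem_centralizer_iff e hγ)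
        ((QuotientGroup.prodEquiv _ _).symm p)) ∂μ₁.prod μ₂ := by
  letI : MeasurableSpace ((G₁ × G₂) ⧸ (Subgroup.centralizer ({γ₁} : Set G₁)).prod (Subgroup.centralizer ({γ₂} : Set G₂))) :=
    borel _
  haveI : BorelSpace ((G₁ × G₂) ⧸ (Subgroup.centralizer ({γ₁} : Set G₁)).prod (Subgroup.centralizer ({γ₂} : Set G₂))) := ⟨rfl⟩
  rw [orbitalMeasureOfProd_eq_map e hγ μ₁ μ₂ he hes, ← Homeomorph.toMeasurableEquiv_coe, lintegral_map_equiv,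
    ← Homeomorph.toMeasurableEquiv_coe, lintegral_map_equiv]
  rfl

omit [SecondCountableTopology (G₁ ⧸ Subgroup.centralizer ({γ₁} : Set G₁))] in
include he hes in
/-- Integrability for `μ₁ ⊠ μ₂` is integrability of the pull-back for `μ₁ ⊗ μ₂`. [cite: Gelbart1975, p. 155 (10.19)] -/
theorem integrable_orbitalMeasureOfProd_iff {E : Type*} [NormedAddCommGroup E] [SFinite μ₂]
    (F : G ⧸ Subgroup.centralizer ({γ} : Set G) → E) :
    Integrable F (orbitalMeasureOfProd e hγ μ₁ μ₂) ↔
      Integrable (fun p => F (cosetCongr e _ (Subgroup.centralizer ({γ} : Set G)) (forall_apply_mem_centralizer_iff e hγ)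
        ((QuotientGroup.prodEquiv _ _).symm p))) (μ₁.prod μ₂) := by
  letI : MeasurableSpace ((G₁ × G₂) ⧸ (Subgroup.centralizer ({γ₁} : Set G₁)).prod (Subgroup.centralizer ({γ₂} : Set G₂))) :=
    borel _
  haveI : BorelSpace ((G₁ × G₂) ⧸ (Subgroup.centralizer ({γ₁} : Set G₁)).prod (Subgroup.centralizer ({γ₂} : Set G₂))) := ⟨rfl⟩
  rw [orbitalMeasureOfProd_eq_map e hγ μ₁ μ₂ he hes, ← Homeomorph.toMeasurableEquiv_coe, integrable_map_equiv,
    ← Homeomorph.toMeasurableEquiv_coe, integrable_map_equiv]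
  rfl

/-! ### Admissibility -/

include he in
/-- **`μ₁ ⊠ μ₂` is `G`-invariant** for `G_i`-invariant `μ_i` (topological groups, second countable orbit spaces).
[cite: Gelbart1975, p. 155 (10.19)] -/
theorem smulInvariantMeasure_orbitalMeasureOfProd [IsTopologicalGroup G]
    [SMulInvariantMeasure G₁ (G₁ ⧸ Subgroup.centralizer ({γ₁} : Set G₁)) μ₁]
    [SMulInvariantMeasure G₂ (G₂ ⧸ Subgroup.centralizer ({γ₂} : Set G₂)) μ₂] [SFinite μ₁] [SFinite μ₂] :
    SMulInvariantMeasure G (G ⧸ Subgroup.centralizer ({γ} : Set G)) (orbitalMeasureOfProd e hγ μ₁ μ₂) := by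
  letI : MeasurableSpace ((G₁ × G₂) ⧸ (Subgroup.centralizer ({γ₁} : Set G₁)).prod (Subgroup.centralizer ({γ₂} : Set G₂))) :=
    borel _
  haveI : BorelSpace ((G₁ × G₂) ⧸ (Subgroup.centralizer ({γ₁} : Set G₁)).prod (Subgroup.centralizer ({γ₂} : Set G₂))) := ⟨rfl⟩
  haveI := smulInvariantMeasure_map_symm_prod (Subgroup.centralizer ({γ₁} : Set G₁)) (Subgroup.centralizer ({γ₂} : Set G₂)) μ₁ μ₂
  exact smulInvariantMeasure_map_cosetCongr_of_smulInvariant e he _ (Subgroup.centralizer ({γ} : Set G))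
    (forall_apply_mem_centralizer_iff e hγ) _

include he hes in
/-- **`μ₁ ⊠ μ₂` is finite on compacta** when `μ₁`, `μ₂` are. [cite: Gelbart1975, p. 155 (10.19)] -/
theorem isFiniteMeasureOnCompacts_orbitalMeasureOfProd [IsFiniteMeasureOnCompacts μ₁] [IsFiniteMeasureOnCompacts μ₂] [SFinite μ₂] :
    IsFiniteMeasureOnCompacts (orbitalMeasureOfProd e hγ μ₁ μ₂) := by
  letI : MeasurableSpace ((G₁ × G₂) ⧸ (Subgroup.centralizer ({γ₁} : Set G₁)).prod (Subgroup.centralizer ({γ₂} : Set G₂))) :=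
    borel _
  haveI : BorelSpace ((G₁ × G₂) ⧸ (Subgroup.centralizer ({γ₁} : Set G₁)).prod (Subgroup.centralizer ({γ₂} : Set G₂))) := ⟨rfl⟩
  haveI := isFiniteMeasureOnCompacts_map_symm_prod (Subgroup.centralizer ({γ₁} : Set G₁))
    (Subgroup.centralizer ({γ₂} : Set G₂)) μ₁ μ₂
  rw [orbitalMeasureOfProd_eq_map e hγ μ₁ μ₂ he hes]
  exact IsFiniteMeasureOnCompacts.map _ _

include he hes in
/-- **`μ₁ ⊠ μ₂ ≠ 0`** when `μ₁, μ₂ ≠ 0`. [cite: Gelbart1975, p. 155 (10.19)] -/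
theorem orbitalMeasureOfProd_ne_zero [SFinite μ₂] (h₁ : μ₁ ≠ 0) (h₂ : μ₂ ≠ 0) : orbitalMeasureOfProd e hγ μ₁ μ₂ ≠ 0 := by
  letI : MeasurableSpace ((G₁ × G₂) ⧸ (Subgroup.centralizer ({γ₁} : Set G₁)).prod (Subgroup.centralizer ({γ₂} : Set G₂))) :=
    borel _
  haveI : BorelSpace ((G₁ × G₂) ⧸ (Subgroup.centralizer ({γ₁} : Set G₁)).prod (Subgroup.centralizer ({γ₂} : Set G₂))) := ⟨rfl⟩
  rw [orbitalMeasureOfProd_eq_map e hγ μ₁ μ₂ he hes, Ne, Measure.map_eq_zero_iff (Homeomorph.measurable _).aemeasurable]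
  exact map_symm_prod_ne_zero _ _ μ₁ μ₂ h₁ h₂

/-! ### The exact factorisation of orbital integrals -/

omit [SecondCountableTopology (G₁ ⧸ Subgroup.centralizer ({γ₁} : Set G₁))] in
include he hes in
/-- **Orbital integrals of factorizable functions factor EXACTLY for `μ₁ ⊠ μ₂`**: for all complex `Φ`, `ξ`, `Θ` with
`Φ(e(a, k)) = ξ(a) Θ(k)`,
`∫_{G/C(γ)} Φ(y γ y⁻¹) d(μ₁ ⊠ μ₂)(y) = (∫_{G₁/C(γ₁)} ξ(a γ₁ a⁻¹) dμ₁(a)) · (∫_{G₂/C(γ₂)} Θ(k γ₂ k⁻¹) dμ₂(k))` — Gelbart's (10.19) with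
the constant `1`, no integrability hypotheses (Bochner conventions on both sides, ★ `integral_prod_mul`). [cite: Gelbart1975, p. 155 (10.19)] -/
theorem integral_descConj_orbitalMeasureOfProd [SFinite μ₁] [SFinite μ₂] (Φ : G → ℂ) (ξ : G₁ → ℂ) (Θ : G₂ → ℂ)
    (hΦ : ∀ a k, Φ (e (a, k)) = ξ a * Θ k) :
    ∫ y, descConj γ (Subgroup.centralizer ({γ} : Set G)) (centralizer_comm γ) Φ y ∂orbitalMeasureOfProd e hγ μ₁ μ₂ =
      (∫ x, descConj γ₁ _ (centralizer_comm _) ξ x ∂μ₁) * ∫ x, descConj γ₂ _ (centralizer_comm _) Θ x ∂μ₂ := by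
  rw [integral_orbitalMeasureOfProd e hγ μ₁ μ₂ he hes, ← integral_prod_mul]
  refine integral_congr_ae (Eventually.of_forall fun p => ?_)
  exact descConj_cosetCongr_prodEquiv_symm e hγ Φ ξ Θ hΦ p.1 p.2

omit [SecondCountableTopology (G₁ ⧸ Subgroup.centralizer ({γ₁} : Set G₁))] in
include he hes in
/-- **The `[0, ∞]`-valued exact factorisation** (Tonelli): for measurable orbital integrands of `ξ, Θ ≥ 0` and `Φ` with
`Φ(e(a, k)) = ξ(a) Θ(k)`, `∫⁻_{G/C(γ)} Φ(yγy⁻¹) d(μ₁ ⊠ μ₂) = (∫⁻ ξ(aγ₁a⁻¹) dμ₁) · (∫⁻ Θ(kγ₂k⁻¹) dμ₂)`.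
[cite: Gelbart1975, p. 155 (10.19)] -/
theorem lintegral_descConj_orbitalMeasureOfProd [SFinite μ₁] [SFinite μ₂] (Φ : G → ℝ≥0∞) (ξ : G₁ → ℝ≥0∞) (Θ : G₂ → ℝ≥0∞)
    (hξ : Measurable (descConj γ₁ _ (centralizer_comm _) ξ)) (hΘ : Measurable (descConj γ₂ _ (centralizer_comm _) Θ))
    (hΦ : ∀ a k, Φ (e (a, k)) = ξ a * Θ k) :
    ∫⁻ y, descConj γ (Subgroup.centralizer ({γ} : Set G)) (centralizer_comm γ) Φ y ∂orbitalMeasureOfProd e hγ μ₁ μ₂ =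
      (∫⁻ x, descConj γ₁ _ (centralizer_comm _) ξ x ∂μ₁) * ∫⁻ x, descConj γ₂ _ (centralizer_comm _) Θ x ∂μ₂ := by
  rw [lintegral_orbitalMeasureOfProd e hγ μ₁ μ₂ he hes, ← lintegral_prod_mul hξ.aemeasurable hΘ.aemeasurable]
  refine lintegral_congr fun p => ?_
  exact descConj_cosetCongr_prodEquiv_symm e hγ Φ ξ Θ hΦ p.1 p.2

omit [SecondCountableTopology (G₁ ⧸ Subgroup.centralizer ({γ₁} : Set G₁))] in
include he hes in
/-- **Integrability of the orbital integrand of `Φ = ξ ⊗ Θ` for `μ₁ ⊠ μ₂` is integrability of `ξ(aγ₁a⁻¹) Θ(kγ₂k⁻¹)` for `μ₁ ⊗ μ₂`.**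
[cite: Gelbart1975, p. 155 (10.19)] -/
theorem integrable_descConj_orbitalMeasureOfProd_iff {E : Type*} [NormedRing E] [SFinite μ₂] (Φ : G → E) (ξ : G₁ → E)
    (Θ : G₂ → E) (hΦ : ∀ a k, Φ (e (a, k)) = ξ a * Θ k) :
    Integrable (descConj γ (Subgroup.centralizer ({γ} : Set G)) (centralizer_comm γ) Φ) (orbitalMeasureOfProd e hγ μ₁ μ₂) ↔
      Integrable (fun p : (G₁ ⧸ Subgroup.centralizer ({γ₁} : Set G₁)) × (G₂ ⧸ Subgroup.centralizer ({γ₂} : Set G₂)) =>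
        descConj γ₁ _ (centralizer_comm _) ξ p.1 * descConj γ₂ _ (centralizer_comm _) Θ p.2) (μ₁.prod μ₂) := by
  rw [integrable_orbitalMeasureOfProd_iff e hγ μ₁ μ₂ he hes]
  have h : (fun p : (G₁ ⧸ Subgroup.centralizer ({γ₁} : Set G₁)) × (G₂ ⧸ Subgroup.centralizer ({γ₂} : Set G₂)) =>
      descConj γ (Subgroup.centralizer ({γ} : Set G)) (centralizer_comm γ) Φ
        (cosetCongr e _ (Subgroup.centralizer ({γ} : Set G)) (forall_apply_mem_centralizer_iff e hγ)
          ((QuotientGroup.prodEquiv _ _).symm p))) =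
      fun p => descConj γ₁ _ (centralizer_comm _) ξ p.1 * descConj γ₂ _ (centralizer_comm _) Θ p.2 :=
    funext fun p => descConj_cosetCongr_prodEquiv_symm e hγ Φ ξ Θ hΦ p.1 p.2
  rw [h]

omit [SecondCountableTopology (G₁ ⧸ Subgroup.centralizer ({γ₁} : Set G₁))] in
include he hes in
/-- **Integrable factors give an integrable orbital integrand** for `μ₁ ⊠ μ₂` (★ `Integrable.mul_prod`).
[cite: Gelbart1975, p. 155 (10.19)] -/
theorem integrable_descConj_orbitalMeasureOfProd {E : Type*} [NormedRing E] [SFinite μ₁] [SFinite μ₂] (Φ : G → E) (ξ : G₁ → E)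
    (Θ : G₂ → E) (hΦ : ∀ a k, Φ (e (a, k)) = ξ a * Θ k)
    (hξ : Integrable (descConj γ₁ _ (centralizer_comm _) ξ) μ₁) (hΘ : Integrable (descConj γ₂ _ (centralizer_comm _) Θ) μ₂) :
    Integrable (descConj γ (Subgroup.centralizer ({γ} : Set G)) (centralizer_comm γ) Φ) (orbitalMeasureOfProd e hγ μ₁ μ₂) := by
  rw [integrable_descConj_orbitalMeasureOfProd_iff e hγ μ₁ μ₂ he hes Φ ξ Θ hΦ]
  exact hξ.mul_prod hΘ

end OfProd

end Literature.MeasureTheory.Group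

end
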